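/-
Copyright (c) 2026. All rights reserved.
Released under Apache 2.0 license as described in the file LICENSE.
-/
import Summits.CriticalPhenomena.LaceExpansionHighD.NobleBoundsNMidSCornerFirst
import Summits.CriticalPhenomena.LaceExpansionHighD.NobleBoundsNMidSCornerLow
import Summits.CriticalPhenomena.LaceExpansionHighD.NobleBoundsNMidECutRFirstLow
import Summits.CriticalPhenomena.LaceExpansionHighD.NobleBoundsNResidualSharpSizeModel
import HarnessLib

/-!
# Fitzner–van der Hofstad (2017), Prop. 5.5 (5.34) at `N = M + 2` against the SHARP blocks, hypothesis-free — Part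
IV §G: the six Sharp slots DISCHARGED from the corner (`R′`) and corner cut-through (`R`) cell packages, and (5.34)
at `N = M + 2` against the Sharp blocks HYPOTHESIS-FREE (`tsum_nobleXiT_le_secStarBSharp`) (WHAT-IF, DIVERGENCE D77;
b2b-lace LEMMAS node N76-X2-D77, module 9/11)

[FvdH17] = R. Fitzner, R. van der Hofstad, *Mean-field behavior for nearest-neighbor percolation in `d > 10`*,
arXiv:1506.07977v2 (EJP 22 (2017), paper 43).  Page numbers refer to the arXiv version.

NAME MAP for the slot docstrings below (carried over verbatim; they cite the node's former working module names):
`NobleBoundsNMidSCorner` §D / §E / §F = modules `NobleBoundsNMidSCornerMid` / `…CornerFirst` / `…CornerLow`;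
`NobleBoundsNMidECutR` §C / §D / §E = modules `NobleBoundsNMidECutRMid` (§C) / `NobleBoundsNMidECutRFirstLow` (§D–§E).

SPLIT PROVENANCE: module 9 of 11 of the b2b-lace node N76-X2-D77 (what-if, DIVERGENCE D77) — the 11 modules are the
section-seam split (carver-g217, 2026-08-27) of the single-module form `NobleBoundsNSharpD77.lean` (carver-g51
text-final, sha256 `877e12977f9f9c92`, 2707 lines): every declaration, statement and proof is carried over verbatim and
in the original order; only module boundaries, the repeated `section`/`variable` headers and two docstrings were added.
PLACEMENT: what-if objects of `NobleBlocksSharp` (b2b-lace LEAN PLACEMENT RULE, REFEREE R491), hence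
`namespace Summit.CriticalPhenomena.LaceExpansionHighD.NobleBlocks`.  Conventions: `d`-generic; every declaration
carries its [FvdH17] display / page cite in the docstring; NOTHING is cited as a fact (b2b-lace ABSOLUTE RULE);
additive (no existing declaration is changed). -/

noncomputable section

namespace Summit.CriticalPhenomena.LaceExpansionHighD.NobleBlocks

open Literature.Probability.FitznerVanDerHofstad2017 Literature.Probability.FitznerVanDerHofstad2017.NobleBlocks
open Literature.Probability.FitznerVanDerHofstad2017.NobleBlocks.LenIdx
open Literature.Probability.LatticeModels Literature.Probability.Percolation
open Literature.Probability.FitznerVanDerHofstad2017.BlockSummation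
open Literature.Barriers.CriticalPhenomena
open Literature.Combinatorics.SimpleGraph _root_.SimpleGraph _root_.MeasureTheory
open scoped BigOperators ENNReal Matrix

variable {d : ℕ}

/-! ### §G. The six SHARP slots DISCHARGED from the corner (`R′`) and corner cut-through (`R`) cell packages, and
(5.34) at `N = M + 2` against the Sharp blocks, HYPOTHESIS-FREE -/

section SharpSlots

variable (p : unitInterval) (M : ℕ)

/-- The statement of the corner cell package of the FIRST junction, `nonempty_jPkg_firstS_corner p M`
(`NobleBoundsNMidSCorner` §E), in its binder order. -/
def CornerFirst : Prop :=
  ∀ (x : Site d) (b : Fin (M + 2) → Site d × Site d) (w t z : Fin (M + 2) → Site d) (a : Fin (M + 2) → Fin 3 ⊕ Unit)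
    (c : Fin 3 ⊕ Unit) (τ : Fin (M + 1) → Bool × Fin 3) (κ : Fin d × Bool),
    (b (0 : Fin (M + 1)).castSucc).2 = (b (0 : Fin (M + 1)).castSucc).1 + stepVec κ → ∀ a₀ a' : Fin 3,
    a (0 : Fin (M + 1)).castSucc = Sum.inl a₀ → a (0 : Fin (M + 1)).succ = Sum.inl a' → (τ 0).1 = false → a' ≠ 0 →
    w (0 : Fin (M + 1)).succ = t (0 : Fin (M + 1)).castSucc →
    Nonempty (JPkg p (jctx M x b w t z a τ (0 : Fin (M + 1)).castSucc) (JFacts M x b w t z a c τ)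
      (blockPS (Letters.perc d p) a₀ (b (0 : Fin (M + 1)).castSucc).1 (w (0 : Fin (M + 1)).castSucc) *
        blockXRPrime (Letters.perc d p) (τ 0).2 κ a₀ a' (b (0 : Fin (M + 1)).castSucc).1
          (w (0 : Fin (M + 1)).castSucc) (t (0 : Fin (M + 1)).castSucc) (z (0 : Fin (M + 1)).castSucc)
          (w (0 : Fin (M + 1)).succ) (b (0 : Fin (M + 1)).succ).1))

/-- The statement of the corner cell package of a MIDDLE junction, `nonempty_jPkg_midS_corner p M`
(`NobleBoundsNMidSCorner` §D), in its binder order. -/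
def CornerMid : Prop :=
  ∀ (x : Site d) (b : Fin (M + 2) → Site d × Site d) (w t z : Fin (M + 2) → Site d) (a : Fin (M + 2) → Fin 3 ⊕ Unit)
    (c : Fin 3 ⊕ Unit) (τ : Fin (M + 1) → Bool × Fin 3) (i i₀ : Fin (M + 1)), i₀.succ = i.castSucc →
    ∀ κ : Fin d × Bool, (b i.castSucc).2 = (b i.castSucc).1 + stepVec κ → ∀ a₀ a' : Fin 3,
    a i.castSucc = Sum.inl a₀ → a i.succ = Sum.inl a' → (τ i).1 = false → a' ≠ 0 → w i.succ = t i.castSucc →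
    Nonempty (JPkg p (jctx M x b w t z a τ i.castSucc) (JFacts M x b w t z a c τ)
      (blockXRPrime (Letters.perc d p) (τ i).2 κ a₀ a' (b i.castSucc).1 (w i.castSucc) (t i.castSucc) (z i.castSucc)
        (w i.succ) (b i.succ).1))

/-- FIRST pair: slot `hR'₀` FOLLOWS from the corner cell package: `cellS (false, c) =
X_{R′,c}` and `cellS ≤ tgtRegB + cellS = tgtRegS`, behind `P^{S,a₀}`. -/
theorem slot_RPrime_first_of_corner (hC : CornerFirst (d := d) p M) :
    ∀ (x : Site d) (a : Fin (M + 2) → Fin 3 ⊕ Unit) (c : Fin 3 ⊕ Unit) (b : Fin (M + 2) → Site d × Site d)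
      (w t z : Fin (M + 2) → Site d),
      ∀ κ : Fin (M + 2) → Fin d × Bool, (∀ i, (b i).2 = (b i).1 + stepVec (κ i)) →
      ∀ τ : Fin (M + 1) → Bool × Fin 3, AdmT M a τ →
      ∀ a₀ a' : Fin 3, a (0 : Fin (M + 1)).castSucc = Sum.inl a₀ → a (0 : Fin (M + 1)).succ = Sum.inl a' →
      (τ 0).1 = false → a' ≠ 0 → w (0 : Fin (M + 1)).succ = t (0 : Fin (M + 1)).castSucc →
      Nonempty (JPkg p (jctx M x b w t z a τ (0 : Fin (M + 1)).castSucc) (JFacts M x b w t z a c τ)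
        (blockPS (Letters.perc d p) a₀ (b (0 : Fin (M + 1)).castSucc).1 (w (0 : Fin (M + 1)).castSucc) *
          tgtRegS (Letters.perc d p) (κ (0 : Fin (M + 1)).castSucc) a₀ a' (b (0 : Fin (M + 1)).castSucc).1
            (w (0 : Fin (M + 1)).castSucc) (t (0 : Fin (M + 1)).castSucc) (z (0 : Fin (M + 1)).castSucc)
            (w (0 : Fin (M + 1)).succ) (b (0 : Fin (M + 1)).succ).1 (τ 0))) := by
  intro x a c b w t z κ hκ τ _ a₀ a' ha ha' hσ ha'0 hwt
  obtain ⟨P⟩ := hC x b w t z a c τ (κ _) (hκ _) a₀ a' ha ha' hσ ha'0 hwt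
  refine ⟨P.monoTgt (mul_le_mul' le_rfl ?_)⟩
  rw [tgtRegS, cellS, if_pos hσ]
  exact le_add_self

/-- MIDDLE pair: slot `hR'` FOLLOWS from the corner cell package. -/
theorem slot_RPrime_mid_of_corner (hC : CornerMid (d := d) p M) :
    ∀ (x : Site d) (a : Fin (M + 2) → Fin 3 ⊕ Unit) (c : Fin 3 ⊕ Unit) (b : Fin (M + 2) → Site d × Site d)
      (w t z : Fin (M + 2) → Site d),
      ∀ κ : Fin (M + 2) → Fin d × Bool, (∀ i, (b i).2 = (b i).1 + stepVec (κ i)) →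
      ∀ τ : Fin (M + 1) → Bool × Fin 3, AdmT M a τ →
      ∀ i i₀ : Fin (M + 1), i₀.succ = i.castSucc → ∀ a₀ a' : Fin 3, a i.castSucc = Sum.inl a₀ →
      a i.succ = Sum.inl a' → (τ i).1 = false → a' ≠ 0 → w i.succ = t i.castSucc →
      Nonempty (JPkg p (jctx M x b w t z a τ i.castSucc) (JFacts M x b w t z a c τ)
        (tgtRegS (Letters.perc d p) (κ i.castSucc) a₀ a' (b i.castSucc).1 (w i.castSucc) (t i.castSucc) (z i.castSucc)
          (w i.succ) (b i.succ).1 (τ i))) := by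
  intro x a c b w t z κ hκ τ _ i i₀ hk a₀ a' ha ha' hσ ha'0 hwt
  obtain ⟨P⟩ := hC x b w t z a c τ i i₀ hk (κ _) (hκ _) a₀ a' ha ha' hσ ha'0 hwt
  refine ⟨P.monoTgt ?_⟩
  rw [tgtRegS, cellS, if_pos hσ]
  exact le_add_self

/-- `CornerFirst` holds: the corner cell package of the first junction (`nonempty_jPkg_firstS_corner`). -/
theorem cornerFirst_holds : CornerFirst (d := d) p M :=
  nonempty_jPkg_firstS_corner p M

/-- `CornerMid` holds: the corner cell package of a middle junction (`nonempty_jPkg_midS_corner`). -/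
theorem cornerMid_holds : CornerMid (d := d) p M :=
  nonempty_jPkg_midS_corner p M

/-- The statement of the corner cut-through cell package of the FIRST junction in the Sharp cell shape,
`nonempty_jPkg_firstE_cutR_sharp p M` (`NobleBoundsNMidECutR` §D), in its binder order:
`P^{S,a₀}(u_0,w_0) · (tgtRegB … (true,0) + X_R)` on `z_0 = t_0 ∼ w_1`, `t_0 ≠ u_1`, `a′ = 2`. -/
def CutRFirst : Prop :=
  ∀ (x : Site d) (b : Fin (M + 2) → Site d × Site d) (w t z : Fin (M + 2) → Site d) (a : Fin (M + 2) → Fin 3 ⊕ Unit)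
    (c : Fin 3 ⊕ Unit) (τ : Fin (M + 1) → Bool × Fin 3) (κ : Fin d × Bool),
    (b (0 : Fin (M + 1)).castSucc).2 = (b (0 : Fin (M + 1)).castSucc).1 + stepVec κ → (τ 0).1 = true →
    ∀ a₀ : Fin 3, a (0 : Fin (M + 1)).castSucc = Sum.inl a₀ → ∀ a' : Fin 3, a (0 : Fin (M + 1)).succ = Sum.inl a' →
    a' = 2 → t (0 : Fin (M + 1)).castSucc ≠ (b (0 : Fin (M + 1)).succ).1 →
    z (0 : Fin (M + 1)).castSucc = t (0 : Fin (M + 1)).castSucc →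
    (zdGraph d).Adj (w (0 : Fin (M + 1)).succ) (t (0 : Fin (M + 1)).castSucc) →
    Nonempty (JPkg p (jctx M x b w t z a τ (0 : Fin (M + 1)).castSucc) (JFacts M x b w t z a c τ)
      (blockPS (Letters.perc d p) a₀ (b (0 : Fin (M + 1)).castSucc).1 (w (0 : Fin (M + 1)).castSucc) *
        (tgtRegB (Letters.perc d p) κ a₀ a' (b (0 : Fin (M + 1)).castSucc).1 (w (0 : Fin (M + 1)).castSucc)
            (t (0 : Fin (M + 1)).castSucc) (z (0 : Fin (M + 1)).castSucc) (w (0 : Fin (M + 1)).succ)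
            (b (0 : Fin (M + 1)).succ).1 (true, 0) +
          blockXR (Letters.perc d p) κ a₀ a' (b (0 : Fin (M + 1)).castSucc).1 (w (0 : Fin (M + 1)).castSucc)
            (t (0 : Fin (M + 1)).castSucc) (z (0 : Fin (M + 1)).castSucc) (w (0 : Fin (M + 1)).succ)
            (b (0 : Fin (M + 1)).succ).1)))

/-- The statement of the corner cut-through cell package of a MIDDLE junction in the Sharp cell shape,
`nonempty_jPkg_midE_cutR_sharp p M` (`NobleBoundsNMidECutR` §C), in its binder order. -/
def CutRMid : Prop :=
  ∀ (x : Site d) (b : Fin (M + 2) → Site d × Site d) (w t z : Fin (M + 2) → Site d) (a : Fin (M + 2) → Fin 3 ⊕ Unit)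
    (c : Fin 3 ⊕ Unit) (τ : Fin (M + 1) → Bool × Fin 3) (i i₀ : Fin (M + 1)), i₀.succ = i.castSucc →
    ∀ κ : Fin d × Bool, (b i.castSucc).2 = (b i.castSucc).1 + stepVec κ → (τ i).1 = true →
    ∀ a₀ : Fin 3, a i.castSucc = Sum.inl a₀ → ∀ a' : Fin 3, a i.succ = Sum.inl a' → a' = 2 →
    t i.castSucc ≠ (b i.succ).1 → z i.castSucc = t i.castSucc → (zdGraph d).Adj (w i.succ) (t i.castSucc) →
    Nonempty (JPkg p (jctx M x b w t z a τ i.castSucc) (JFacts M x b w t z a c τ)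
      (tgtRegB (Letters.perc d p) κ a₀ a' (b i.castSucc).1 (w i.castSucc) (t i.castSucc) (z i.castSucc) (w i.succ)
          (b i.succ).1 (true, 0) +
        blockXR (Letters.perc d p) κ a₀ a' (b i.castSucc).1 (w i.castSucc) (t i.castSucc) (z i.castSucc) (w i.succ)
          (b i.succ).1))

/-- FIRST pair: slot `hR₀` FOLLOWS from the corner cut-through cell package:
`tgtRegS … (true,0) = tgtRegB … (true,0) + cellS … (true,0)` and `cellS … (true,0) = X_R`, behind `P^{S,a₀}`. -/
theorem slot_R_first_of_cutR (hC : CutRFirst (d := d) p M) :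
    ∀ (x : Site d) (a : Fin (M + 2) → Fin 3 ⊕ Unit) (c : Fin 3 ⊕ Unit) (b : Fin (M + 2) → Site d × Site d)
      (w t z : Fin (M + 2) → Site d),
      ∀ κ : Fin (M + 2) → Fin d × Bool, (∀ i, (b i).2 = (b i).1 + stepVec (κ i)) →
      ∀ τ : Fin (M + 1) → Bool × Fin 3, AdmT M a τ →
      ∀ a₀ a' : Fin 3, a (0 : Fin (M + 1)).castSucc = Sum.inl a₀ → a (0 : Fin (M + 1)).succ = Sum.inl a' →
      τ 0 = (true, 0) → a' = 2 → t (0 : Fin (M + 1)).castSucc ≠ (b (0 : Fin (M + 1)).succ).1 →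
      z (0 : Fin (M + 1)).castSucc = t (0 : Fin (M + 1)).castSucc →
      (zdGraph d).Adj (w (0 : Fin (M + 1)).succ) (t (0 : Fin (M + 1)).castSucc) →
      Nonempty (JPkg p (jctx M x b w t z a τ (0 : Fin (M + 1)).castSucc) (JFacts M x b w t z a c τ)
        (blockPS (Letters.perc d p) a₀ (b (0 : Fin (M + 1)).castSucc).1 (w (0 : Fin (M + 1)).castSucc) *
          tgtRegS (Letters.perc d p) (κ (0 : Fin (M + 1)).castSucc) a₀ a' (b (0 : Fin (M + 1)).castSucc).1
            (w (0 : Fin (M + 1)).castSucc) (t (0 : Fin (M + 1)).castSucc) (z (0 : Fin (M + 1)).castSucc)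
            (w (0 : Fin (M + 1)).succ) (b (0 : Fin (M + 1)).succ).1 (τ 0))) := by
  intro x a c b w t z κ hκ τ _ a₀ a' ha ha' hv h2 hty hzt hadj
  obtain ⟨P⟩ := hC x b w t z a c τ (κ _) (hκ _) (by rw [hv]) a₀ ha a' ha' h2 hty hzt hadj
  refine ⟨P.monoTgt (mul_le_mul' le_rfl (le_of_eq ?_))⟩
  rw [hv, tgtRegS, cellS, if_neg (by decide), if_pos rfl]

/-- MIDDLE pair: slot `hR` FOLLOWS from the corner cut-through cell package. -/
theorem slot_R_mid_of_cutR (hC : CutRMid (d := d) p M) :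
    ∀ (x : Site d) (a : Fin (M + 2) → Fin 3 ⊕ Unit) (c : Fin 3 ⊕ Unit) (b : Fin (M + 2) → Site d × Site d)
      (w t z : Fin (M + 2) → Site d),
      ∀ κ : Fin (M + 2) → Fin d × Bool, (∀ i, (b i).2 = (b i).1 + stepVec (κ i)) →
      ∀ τ : Fin (M + 1) → Bool × Fin 3, AdmT M a τ →
      ∀ i i₀ : Fin (M + 1), i₀.succ = i.castSucc → ∀ a₀ a' : Fin 3, a i.castSucc = Sum.inl a₀ →
      a i.succ = Sum.inl a' → τ i = (true, 0) → a' = 2 → t i.castSucc ≠ (b i.succ).1 →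
      z i.castSucc = t i.castSucc → (zdGraph d).Adj (w i.succ) (t i.castSucc) →
      Nonempty (JPkg p (jctx M x b w t z a τ i.castSucc) (JFacts M x b w t z a c τ)
        (tgtRegS (Letters.perc d p) (κ i.castSucc) a₀ a' (b i.castSucc).1 (w i.castSucc) (t i.castSucc) (z i.castSucc)
          (w i.succ) (b i.succ).1 (τ i))) := by
  intro x a c b w t z κ hκ τ _ i i₀ hk a₀ a' ha ha' hv h2 hty hzt hadj
  obtain ⟨P⟩ := hC x b w t z a c τ i i₀ hk (κ _) (hκ _) (by rw [hv]) a₀ ha a' ha' h2 hty hzt hadj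
  refine ⟨P.monoTgt (le_of_eq ?_)⟩
  rw [hv, tgtRegS, cellS, if_neg (by decide), if_pos rfl]

/-- `CutRFirst` holds: the corner cut-through cell package of the first junction (`nonempty_jPkg_firstE_cutR_sharp`). -/
theorem cutRFirst_holds : CutRFirst (d := d) p M :=
  nonempty_jPkg_firstE_cutR_sharp p M

/-- `CutRMid` holds: the corner cut-through cell package of a middle junction (`nonempty_jPkg_midE_cutR_sharp`). -/
theorem cutRMid_holds : CutRMid (d := d) p M :=
  nonempty_jPkg_midE_cutR_sharp p M

/-- The statement of the corner cell package of a MIDDLE lower-`★` pair (closed lower level, pinned section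
`z_k = w_k`), `nonempty_jPkg_lowS_corner p M` (`NobleBoundsNMidSCorner` §F), in its binder order. -/
def CornerLow : Prop :=
  ∀ (x : Site d) (b : Fin (M + 2) → Site d × Site d) (w t z : Fin (M + 2) → Site d) (a : Fin (M + 2) → Fin 3 ⊕ Unit)
    (c : Fin 3 ⊕ Unit) (τ : Fin (M + 1) → Bool × Fin 3) (i i₀ : Fin (M + 1)), i₀.succ = i.castSucc →
    ∀ κ : Fin d × Bool, (b i.castSucc).2 = (b i.castSucc).1 + stepVec κ → ∀ (u₀ : Unit) (a' : Fin 3),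
    a i.castSucc = Sum.inr u₀ → a i.succ = Sum.inl a' → (τ i).1 = false → a' ≠ 0 → w i.succ = t i.castSucc →
    z i.castSucc = w i.castSucc →
    Nonempty (JPkg p (jctx M x b w t z a τ i.castSucc) (JFacts M x b w t z a c τ)
      (blockXRPrime (Letters.perc d p) (τ i).2 κ 2 a' (b i.castSucc).1 (w i.castSucc) (t i.castSucc) (z i.castSucc)
        (w i.succ) (b i.succ).1))

/-- The statement of the corner cut-through cell package of a MIDDLE lower-`★` pair in the Sharp cell shape,
`nonempty_jPkg_lowE_cutR_sharp p M` (`NobleBoundsNMidECutR` §E), in its binder order (the corner hypothesis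
`w_{k+1} ~ t_k` is not needed at lower row `2`). -/
def CutRLow : Prop :=
  ∀ (x : Site d) (b : Fin (M + 2) → Site d × Site d) (w t z : Fin (M + 2) → Site d) (a : Fin (M + 2) → Fin 3 ⊕ Unit)
    (c : Fin 3 ⊕ Unit) (τ : Fin (M + 1) → Bool × Fin 3) (i i₀ : Fin (M + 1)), i₀.succ = i.castSucc →
    ∀ κ : Fin d × Bool, (b i.castSucc).2 = (b i.castSucc).1 + stepVec κ → (τ i).1 = true →
    ∀ (u₀ : Unit), a i.castSucc = Sum.inr u₀ → ∀ a' : Fin 3, a i.succ = Sum.inl a' → a' = 2 →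
    t i.castSucc ≠ (b i.succ).1 → z i.castSucc = t i.castSucc → z i.castSucc = w i.castSucc →
    Nonempty (JPkg p (jctx M x b w t z a τ i.castSucc) (JFacts M x b w t z a c τ)
      (tgtReg (Letters.perc d p) κ 2 a' (b i.castSucc).1 (w i.castSucc) (t i.castSucc) (z i.castSucc) (w i.succ)
          (b i.succ).1 (true, 0) +
        blockXR (Letters.perc d p) κ 2 a' (b i.castSucc).1 (w i.castSucc) (t i.castSucc) (z i.castSucc) (w i.succ)
          (b i.succ).1))

/-- lower-`★` `R′`: slot `hR'L` FOLLOWS from the lower-`★` corner cell package: off the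
pin `z_k = w_k` the piece is empty (`nonempty_jPkg_of_closedL_of_ne`) and `tgtStarLS = 0`; on it
`tgtStarLS … (false,c) = tgtReg … + cellS …` and `cellS … (false,c) = X_{R′,c}`. -/
theorem slot_RPrime_lowStar_of_corner (hC : CornerLow (d := d) p M) :
    ∀ (x : Site d) (a : Fin (M + 2) → Fin 3 ⊕ Unit) (c : Fin 3 ⊕ Unit) (b : Fin (M + 2) → Site d × Site d)
      (w t z : Fin (M + 2) → Site d),
      ∀ κ : Fin (M + 2) → Fin d × Bool, (∀ i, (b i).2 = (b i).1 + stepVec (κ i)) →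
      ∀ τ : Fin (M + 1) → Bool × Fin 3, AdmT M a τ →
      ∀ i i₀ : Fin (M + 1), i₀.succ = i.castSucc → ∀ (u₀ : Unit) (a' : Fin 3), a i.castSucc = Sum.inr u₀ →
      a i.succ = Sum.inl a' → (τ i).1 = false → a' ≠ 0 → w i.succ = t i.castSucc →
      Nonempty (JPkg p (jctx M x b w t z a τ i.castSucc) (JFacts M x b w t z a c τ)
        (tgtStarLS (Letters.perc d p) (κ i.castSucc) a' (b i.castSucc).1 (w i.castSucc) (t i.castSucc) (z i.castSucc)
          (w i.succ) (b i.succ).1 (τ i))) := by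
  intro x a c b w t z κ hκ τ _ i i₀ hk u₀ a' ha ha' hσ ha'0 hwt
  by_cases hzw : z i.castSucc = w i.castSucc
  · obtain ⟨P⟩ := hC x b w t z a c τ i i₀ hk (κ _) (hκ _) u₀ a' ha ha' hσ ha'0 hwt hzw
    refine ⟨P.monoTgt ?_⟩
    rw [tgtStarLS, if_pos hzw, cellS, if_pos hσ]
    exact le_add_self
  · rw [tgtStarLS, if_neg hzw]
    exact nonempty_jPkg_of_closedL_of_ne p M x b w t z a c τ i i₀ hk ha hzw _

/-- lower-`★` `R`: slot `hRL` FOLLOWS from the lower-`★` corner cut-through cell package: on the pin `tgtStarLS … (true,0) = tgtReg … (true,0) + X_R`. -/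
theorem slot_R_lowStar_of_cutR (hC : CutRLow (d := d) p M) :
    ∀ (x : Site d) (a : Fin (M + 2) → Fin 3 ⊕ Unit) (c : Fin 3 ⊕ Unit) (b : Fin (M + 2) → Site d × Site d)
      (w t z : Fin (M + 2) → Site d),
      ∀ κ : Fin (M + 2) → Fin d × Bool, (∀ i, (b i).2 = (b i).1 + stepVec (κ i)) →
      ∀ τ : Fin (M + 1) → Bool × Fin 3, AdmT M a τ →
      ∀ i i₀ : Fin (M + 1), i₀.succ = i.castSucc → ∀ (u₀ : Unit) (a' : Fin 3), a i.castSucc = Sum.inr u₀ →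
      a i.succ = Sum.inl a' → (τ i).1 = true → (τ i).2 = 0 → a' = 2 → t i.castSucc ≠ (b i.succ).1 →
      z i.castSucc = t i.castSucc → z i.castSucc = w i.castSucc → (zdGraph d).Adj (w i.succ) (t i.castSucc) →
      Nonempty (JPkg p (jctx M x b w t z a τ i.castSucc) (JFacts M x b w t z a c τ)
        (tgtStarLS (Letters.perc d p) (κ i.castSucc) a' (b i.castSucc).1 (w i.castSucc) (t i.castSucc) (z i.castSucc)
          (w i.succ) (b i.succ).1 (τ i))) := by
  intro x a c b w t z κ hκ τ _ i i₀ hk u₀ a' ha ha' hσ hc h2 hty hzt hzw _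
  have hv : τ i = (true, 0) := Prod.ext hσ hc
  obtain ⟨P⟩ := hC x b w t z a c τ i i₀ hk (κ _) (hκ _) hσ u₀ ha a' ha' h2 hty hzt hzw
  refine ⟨P.monoTgt (le_of_eq ?_)⟩
  rw [tgtStarLS, if_pos hzw, hv, cellS, if_neg (by decide), if_pos rfl]

/-- `CornerLow` holds: the corner cell package of a middle lower-`★` pair (`nonempty_jPkg_lowS_corner`). -/
theorem cornerLow_holds : CornerLow (d := d) p M :=
  nonempty_jPkg_lowS_corner p M

/-- `CutRLow` holds: the corner cut-through cell package of a middle lower-`★` pair (`nonempty_jPkg_lowE_cutR_sharp`). -/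
theorem cutRLow_holds : CutRLow (d := d) p M :=
  nonempty_jPkg_lowE_cutR_sharp p M

/-- Slot `hR'₀` of `tsum_nobleXiT_le_secStarBSharp_of_sharpSlots`: from the corner cell package of the first junction. -/
theorem slotPkg_RPrime_first :
    ∀ (x : Site d) (a : Fin (M + 2) → Fin 3 ⊕ Unit) (c : Fin 3 ⊕ Unit) (b : Fin (M + 2) → Site d × Site d)
      (w t z : Fin (M + 2) → Site d),
      ∀ κ : Fin (M + 2) → Fin d × Bool, (∀ i, (b i).2 = (b i).1 + stepVec (κ i)) →
      ∀ τ : Fin (M + 1) → Bool × Fin 3, AdmT M a τ →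
      ∀ a₀ a' : Fin 3, a (0 : Fin (M + 1)).castSucc = Sum.inl a₀ → a (0 : Fin (M + 1)).succ = Sum.inl a' →
      (τ 0).1 = false → a' ≠ 0 → w (0 : Fin (M + 1)).succ = t (0 : Fin (M + 1)).castSucc →
      Nonempty (JPkg p (jctx M x b w t z a τ (0 : Fin (M + 1)).castSucc) (JFacts M x b w t z a c τ)
        (blockPS (Letters.perc d p) a₀ (b (0 : Fin (M + 1)).castSucc).1 (w (0 : Fin (M + 1)).castSucc) *
          tgtRegS (Letters.perc d p) (κ (0 : Fin (M + 1)).castSucc) a₀ a' (b (0 : Fin (M + 1)).castSucc).1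
            (w (0 : Fin (M + 1)).castSucc) (t (0 : Fin (M + 1)).castSucc) (z (0 : Fin (M + 1)).castSucc)
            (w (0 : Fin (M + 1)).succ) (b (0 : Fin (M + 1)).succ).1 (τ 0))) :=
  slot_RPrime_first_of_corner p M (cornerFirst_holds p M)

/-- Slot `hR₀` of `tsum_nobleXiT_le_secStarBSharp_of_sharpSlots`: from the corner cut-through cell package of the first
junction (cut-through `z_0 = t_0 ∼ w_1`, `t_0 ≠ u_1`). -/
theorem slotPkg_R_first :
    ∀ (x : Site d) (a : Fin (M + 2) → Fin 3 ⊕ Unit) (c : Fin 3 ⊕ Unit) (b : Fin (M + 2) → Site d × Site d)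
      (w t z : Fin (M + 2) → Site d),
      ∀ κ : Fin (M + 2) → Fin d × Bool, (∀ i, (b i).2 = (b i).1 + stepVec (κ i)) →
      ∀ τ : Fin (M + 1) → Bool × Fin 3, AdmT M a τ →
      ∀ a₀ a' : Fin 3, a (0 : Fin (M + 1)).castSucc = Sum.inl a₀ → a (0 : Fin (M + 1)).succ = Sum.inl a' →
      τ 0 = (true, 0) → a' = 2 → t (0 : Fin (M + 1)).castSucc ≠ (b (0 : Fin (M + 1)).succ).1 →
      z (0 : Fin (M + 1)).castSucc = t (0 : Fin (M + 1)).castSucc →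
      (zdGraph d).Adj (w (0 : Fin (M + 1)).succ) (t (0 : Fin (M + 1)).castSucc) →
      Nonempty (JPkg p (jctx M x b w t z a τ (0 : Fin (M + 1)).castSucc) (JFacts M x b w t z a c τ)
        (blockPS (Letters.perc d p) a₀ (b (0 : Fin (M + 1)).castSucc).1 (w (0 : Fin (M + 1)).castSucc) *
          tgtRegS (Letters.perc d p) (κ (0 : Fin (M + 1)).castSucc) a₀ a' (b (0 : Fin (M + 1)).castSucc).1
            (w (0 : Fin (M + 1)).castSucc) (t (0 : Fin (M + 1)).castSucc) (z (0 : Fin (M + 1)).castSucc)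
            (w (0 : Fin (M + 1)).succ) (b (0 : Fin (M + 1)).succ).1 (τ 0))) :=
  slot_R_first_of_cutR p M (cutRFirst_holds p M)

/-- Slot `hR'` of `tsum_nobleXiT_le_secStarBSharp_of_sharpSlots`: from the corner cell package of a middle junction. -/
theorem slotPkg_RPrime_mid :
    ∀ (x : Site d) (a : Fin (M + 2) → Fin 3 ⊕ Unit) (c : Fin 3 ⊕ Unit) (b : Fin (M + 2) → Site d × Site d)
      (w t z : Fin (M + 2) → Site d),
      ∀ κ : Fin (M + 2) → Fin d × Bool, (∀ i, (b i).2 = (b i).1 + stepVec (κ i)) →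
      ∀ τ : Fin (M + 1) → Bool × Fin 3, AdmT M a τ →
      ∀ i i₀ : Fin (M + 1), i₀.succ = i.castSucc → ∀ a₀ a' : Fin 3, a i.castSucc = Sum.inl a₀ →
      a i.succ = Sum.inl a' → (τ i).1 = false → a' ≠ 0 → w i.succ = t i.castSucc →
      Nonempty (JPkg p (jctx M x b w t z a τ i.castSucc) (JFacts M x b w t z a c τ)
        (tgtRegS (Letters.perc d p) (κ i.castSucc) a₀ a' (b i.castSucc).1 (w i.castSucc) (t i.castSucc) (z i.castSucc)
          (w i.succ) (b i.succ).1 (τ i))) :=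
  slot_RPrime_mid_of_corner p M (cornerMid_holds p M)

/-- Slot `hR` of `tsum_nobleXiT_le_secStarBSharp_of_sharpSlots`: from the corner cut-through cell package of a middle
regular pair. -/
theorem slotPkg_R_mid :
    ∀ (x : Site d) (a : Fin (M + 2) → Fin 3 ⊕ Unit) (c : Fin 3 ⊕ Unit) (b : Fin (M + 2) → Site d × Site d)
      (w t z : Fin (M + 2) → Site d),
      ∀ κ : Fin (M + 2) → Fin d × Bool, (∀ i, (b i).2 = (b i).1 + stepVec (κ i)) →
      ∀ τ : Fin (M + 1) → Bool × Fin 3, AdmT M a τ →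
      ∀ i i₀ : Fin (M + 1), i₀.succ = i.castSucc → ∀ a₀ a' : Fin 3, a i.castSucc = Sum.inl a₀ →
      a i.succ = Sum.inl a' → τ i = (true, 0) → a' = 2 → t i.castSucc ≠ (b i.succ).1 →
      z i.castSucc = t i.castSucc → (zdGraph d).Adj (w i.succ) (t i.castSucc) →
      Nonempty (JPkg p (jctx M x b w t z a τ i.castSucc) (JFacts M x b w t z a c τ)
        (tgtRegS (Letters.perc d p) (κ i.castSucc) a₀ a' (b i.castSucc).1 (w i.castSucc) (t i.castSucc) (z i.castSucc)
          (w i.succ) (b i.succ).1 (τ i))) :=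
  slot_R_mid_of_cutR p M (cutRMid_holds p M)

/-- Slot `hR'L` of `tsum_nobleXiT_le_secStarBSharp_of_sharpSlots`: from the lower-`★` corner cell package of a middle
lower-`★` pair (closed lower level). -/
theorem slotPkg_RPrime_lowStar :
    ∀ (x : Site d) (a : Fin (M + 2) → Fin 3 ⊕ Unit) (c : Fin 3 ⊕ Unit) (b : Fin (M + 2) → Site d × Site d)
      (w t z : Fin (M + 2) → Site d),
      ∀ κ : Fin (M + 2) → Fin d × Bool, (∀ i, (b i).2 = (b i).1 + stepVec (κ i)) →
      ∀ τ : Fin (M + 1) → Bool × Fin 3, AdmT M a τ →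
      ∀ i i₀ : Fin (M + 1), i₀.succ = i.castSucc → ∀ (u₀ : Unit) (a' : Fin 3), a i.castSucc = Sum.inr u₀ →
      a i.succ = Sum.inl a' → (τ i).1 = false → a' ≠ 0 → w i.succ = t i.castSucc →
      Nonempty (JPkg p (jctx M x b w t z a τ i.castSucc) (JFacts M x b w t z a c τ)
        (tgtStarLS (Letters.perc d p) (κ i.castSucc) a' (b i.castSucc).1 (w i.castSucc) (t i.castSucc) (z i.castSucc)
          (w i.succ) (b i.succ).1 (τ i))) :=
  slot_RPrime_lowStar_of_corner p M (cornerLow_holds p M)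

/-- Slot `hRL` of `tsum_nobleXiT_le_secStarBSharp_of_sharpSlots`: from the lower-`★` corner cut-through cell package of
a middle lower-`★` pair. -/
theorem slotPkg_R_lowStar :
    ∀ (x : Site d) (a : Fin (M + 2) → Fin 3 ⊕ Unit) (c : Fin 3 ⊕ Unit) (b : Fin (M + 2) → Site d × Site d)
      (w t z : Fin (M + 2) → Site d),
      ∀ κ : Fin (M + 2) → Fin d × Bool, (∀ i, (b i).2 = (b i).1 + stepVec (κ i)) →
      ∀ τ : Fin (M + 1) → Bool × Fin 3, AdmT M a τ →
      ∀ i i₀ : Fin (M + 1), i₀.succ = i.castSucc → ∀ (u₀ : Unit) (a' : Fin 3), a i.castSucc = Sum.inr u₀ →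
      a i.succ = Sum.inl a' → (τ i).1 = true → (τ i).2 = 0 → a' = 2 → t i.castSucc ≠ (b i.succ).1 →
      z i.castSucc = t i.castSucc → z i.castSucc = w i.castSucc → (zdGraph d).Adj (w i.succ) (t i.castSucc) →
      Nonempty (JPkg p (jctx M x b w t z a τ i.castSucc) (JFacts M x b w t z a c τ)
        (tgtStarLS (Letters.perc d p) (κ i.castSucc) a' (b i.castSucc).1 (w i.castSucc) (t i.castSucc) (z i.castSucc)
          (w i.succ) (b i.succ).1 (τ i))) :=
  slot_R_lowStar_of_cutR p M (cutRLow_holds p M)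

/-- **(5.34) at `N = M + 2` against the SHARP blocks, HYPOTHESIS-FREE** (b2b-lace LEMMAS node N76-X2-D77):
`Σ_x Ξ̃^{N,T}(x) ≤ Σ (bond weights) · secStarBpt (B♯) 2 0 …` where `B♯ = blockBSharpFull L` carries, besides the
printed `(B')^{ι/κ}` payload of [FvdH17] (5.34), the two residue cells of DIVERGENCE D77 priced honestly: the corner
`w_{k+1} = t_k` (`R′`, row `X_{R′,c} = A'^{κ,a,c,*}·A♯^{c,a′}`, the `x = 0` slice the printed Table `A^{a,b}` lacks) and
the cut-through `z_k = t_k ∼ w_{k+1}`, `t_k ≠ u_{k+1}` (`R`, row `X_R = δ_{z,t}·T2♯`).  Composition of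
`tsum_nobleXiT_le_secStarBSharp_of_sharpSlots` with the six slot packages above; no slot hypothesis remains.
[cite: FitznerVanDerHofstad2017, Prop. 5.5 (5.34) (arXiv:1506.07977v2 p. 52); §5.1 (5.4) (p. 48); §4.4 (4.61)–(4.66) (pp. 41–42); App. B (pp. 73–75)] -/
theorem tsum_nobleXiT_le_secStarBSharp :
    ∑' x, nobleXiT d p (M + 2) x ≤
      vecP (starS (blockPS (Letters.perc d p))) ᵥ*
        matB (starB (blockBFullB' (Letters.perc d p) (blockX₂Sharp (Letters.perc d p)))
          (secEc (blockBFullpt' (Letters.perc d p) (blockXSharp (Letters.perc d p))) 0)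
          (secEo (blockBFullpt' (Letters.perc d p) (blockXSharp (Letters.perc d p))) 2)
          (secEoc (blockBFullpt' (Letters.perc d p) (blockXSharp (Letters.perc d p))) 2 0)) ^ (M + 1) ᵥ*
          matAbar (starA (blockAbar' (Letters.perc d p)) (secEA (blockAbar' (Letters.perc d p)) 2)) ⬝ᵥ
        vecP (starS (blockPE (Letters.perc d p))) :=
  tsum_nobleXiT_le_secStarBSharp_of_sharpSlots p M (slotPkg_RPrime_first p M) (slotPkg_R_first p M)
    (slotPkg_RPrime_mid p M) (slotPkg_R_mid p M) (slotPkg_RPrime_lowStar p M) (slotPkg_R_lowStar p M)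

end SharpSlots

end Summit.CriticalPhenomena.LaceExpansionHighD.NobleBlocks

end
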